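import Mathlib.MeasureTheory.Constructions.Pi
import Mathlib.MeasureTheory.Measure.Lebesgue.Basic
import Literature.NumberTheory.Transcendental.KZLogCalculusProofs
import Literature.NumberTheory.Transcendental.KZDominatedFamilyRelations
import Literature.NumberTheory.Transcendental.KZSemialgebraicComplex
import Literature.NumberTheory.Transcendental.SemialgebraicMapsProofs

/-!
# `NormalFormPrinciple` (stmt-KontsevichZagierPeriods-3869), line `SketchIdeator1` — sub-goal
# `slabA_sub_pt_mem_relations`: Newton–Leibniz over the point, algebraic ends, abstract primitive

Pure proof file (siege k13 of the registered sub-goal `slabA_sub_pt_mem_relations` of the crux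
`HurwitzMicroSectors.NormalFormPrinciple`; `--supports` the crux). It proves, verbatim, the
algebraic-endpoint form of the Newton–Leibniz move over `ℝ⁰` used by the algebraic-pole layer of
the leaf `stub_boxRigidity`:

  for real algebraic `α ≤ β`, an interval representation `N = [(α,β), f]` and a primitive `F` of
  `f` on `(α,β)` which is continuous on `[α,β]` and `ℚ`-semialgebraic (read on the first
  coordinate) on the closed slab, `[N] − [pt, F β − F α] ∈ KZ.relations`.

The proof is rule (3) on the closed slab `{α ≤ x₀ ≤ β}` over the base `ℝ⁰` (boundary functions
the algebraic constants `α`, `β`, primitive `z ↦ F (z 0)`), followed by rule (1a) across the two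
null endpoint hyperplanes (`MeasureTheory.Measure.pi_hyperplane`) and a congruence with `N`.
Semialgebraicity of the closed slab is read off the graph of `F` (`IsSemialgebraicFunOn.isSemialgebraic_holds`,
Tarski–Seidenberg), so no rationality of the ends is needed anywhere.

Sources: M. Kontsevich, D. Zagier, *Periods* (2001), §1.2 rules (1), (3). No definitions are
introduced; only Literature KZ-calculus files and Mathlib are imported.
-/

noncomputable section

open MeasureTheory Set
open Literature.NumberTheory.Transcendental Literature.NumberTheory.Transcendental.KZ
open Literature.ModelTheory.ExponentialFields (IsSemialgebraic isSemialgebraic_univ)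

namespace Summit.KontsevichZagierPeriods.HurwitzMicroSectors.NormalFormPrinciple.PiBox.SiegeK13

/-- The closed coordinate slab minus the open one lies in the two endpoint hyperplanes
`{x₀ = α} ∪ {x₀ = β}`, which are Lebesgue-null (product measure with an atomless factor,
`MeasureTheory.Measure.pi_hyperplane`). [folklore] -/
theorem volume_closedSlab_diff_openSlab (α β : ℝ) :
    volume ({x : Fin 1 → ℝ | x 0 ∈ Set.Icc α β} \ {x : Fin 1 → ℝ | x 0 ∈ Set.Ioo α β}) = 0 := by
  have hplane : ∀ c : ℝ, volume {x : Fin 1 → ℝ | x 0 = c} = 0 := fun c => by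
    rw [volume_pi]
    exact Measure.pi_hyperplane (fun _ : Fin 1 => (volume : Measure ℝ)) 0 c
  refine measure_mono_null (fun x hx => ?_) (measure_union_null (hplane α) (hplane β))
  obtain ⟨⟨h1, h2⟩, h3⟩ := hx
  simp only [Set.mem_setOf_eq, Set.mem_Ioo, not_and, not_lt] at h3
  simp only [Set.mem_union, Set.mem_setOf_eq]
  rcases h1.lt_or_eq with h1 | h1
  · exact Or.inr (le_antisymm h2 (h3 h1))
  · exact Or.inl h1.symm

/-- **Newton–Leibniz over the point, algebraic ends, abstract primitive** (rule 3, plus the null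
endpoints, rule 1a). Let `α ≤ β` be real algebraic numbers, `N = [(α,β), f]` an interval
representation whose integrand `x ↦ f(x₀)` is `ℚ`-semialgebraic on the closed slab, and `F` a
primitive of `f` on `(α,β)`, continuous on `[α,β]`, with `x ↦ F(x₀)` `ℚ`-semialgebraic on the
closed slab. Then `[N] − [pt, F(β) − F(α)] ∈ relations` for every point representation with that
constant. [cite: KontsevichZagier2001, §1.2 rule (3)] -/
theorem slabA_sub_pt_mem_relations {α β : ℝ} (hα : IsAlgebraic ℚ α) (hβ : IsAlgebraic ℚ β)
    (hαβ : α ≤ β) (f F : ℝ → ℝ)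
    (hF : IsSemialgebraicFunOn ℚ {x : Fin 1 → ℝ | x 0 ∈ Set.Icc α β} (fun x => F (x 0)))
    (hFc : ContinuousOn F (Set.Icc α β)) (hderiv : ∀ t ∈ Set.Ioo α β, HasDerivAt F (f t) t)
    (hf : IsSemialgebraicFunOn ℚ {x : Fin 1 → ℝ | x 0 ∈ Set.Icc α β} (fun x => f (x 0)))
    (N : IntegralRep 1) (hNd : N.domain = {x | x 0 ∈ Set.Ioo α β})
    (hNi : EqOn N.integrand (fun x => f (x 0)) N.domain) (Z : IntegralRep 0) (hZd : Z.domain = univ)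
    (hZi : Z.integrand = fun _ => F β - F α) : of N - of Z ∈ relations := by
  have hnull₀ := volume_closedSlab_diff_openSlab α β
  set C : Set (Fin 1 → ℝ) := {x | x 0 ∈ Set.Icc α β} with hC
  -- the closed slab is the domain of the semialgebraic function `x ↦ F (x 0)` (Tarski–Seidenberg)
  have hCsa : IsSemialgebraic ℚ C := IsSemialgebraicFunOn.isSemialgebraic_holds hF
  have hEsa : IsSemialgebraic ℚ {x : Fin 1 → ℝ | x 0 ∈ Set.Ioo α β} := by
    rw [← hNd]; exact N.isSemialgebraic_domain
  have hEC : {x : Fin 1 → ℝ | x 0 ∈ Set.Ioo α β} ⊆ C := by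
    rw [hC]; exact fun x hx => Set.Ioo_subset_Icc_self hx
  -- the integrand `f (x 0)` is integrable on the closed slab (it is `N.integrand` a.e.)
  have hfi : IntegrableOn (fun x : Fin 1 → ℝ => f (x 0)) C := by
    have h1 : IntegrableOn (fun x : Fin 1 → ℝ => f (x 0)) {x : Fin 1 → ℝ | x 0 ∈ Set.Ioo α β} := by
      rw [← hNd]
      exact N.integrableOn.congr_fun hNi
        (IsSemialgebraic.measurableSet_holds N.isSemialgebraic_domain)
    refine h1.congr_set_ae (ae_eq_set.mpr ⟨?_, ?_⟩)
    · rw [hC]; exact hnull₀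
    · exact measure_mono_null (fun x hx => (hx.2 (hEC hx.1)).elim) measure_empty
  -- the closed-slab representation `R = [[α,β], f]`
  obtain ⟨R, hRd, hRi⟩ : ∃ R : IntegralRep 1, R.domain = C ∧ R.integrand = fun x => f (x 0) :=
    ⟨⟨C, fun x => f (x 0), hCsa, hf, hfi⟩, rfl, rfl⟩
  have hs0 : ∀ (x : Fin 0 → ℝ) (t : ℝ), (Fin.snoc x t : Fin 1 → ℝ) 0 = t := fun _ _ => rfl
  -- (i) ONE Newton–Leibniz move over `ℝ⁰`: `[R] − [Z] ∈ newtonLeibnizRel`, primitive `F (z 0)`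
  have hNL : of R - of Z ∈ newtonLeibnizRel := by
    refine ⟨0, R, Z, fun _ => α, fun _ => β, fun z => F (z 0), ?_, ?_, ?_,
      fun _ _ => hαβ, ?_, ?_, ?_, ?_, rfl⟩
    · rw [hRd]
      exact hF
    · rw [hZd]
      exact isSemialgebraicFunOn_const_of_isAlgebraic isSemialgebraic_univ hα
    · rw [hZd]
      exact isSemialgebraicFunOn_const_of_isAlgebraic isSemialgebraic_univ hβ
    · rw [hRd, hZd, hC]
      ext z
      simp only [Set.mem_setOf_eq, Set.mem_Icc, Set.mem_univ, true_and]
      rfl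
    · -- continuity of `t ↦ F t` on the closed fibre
      intro x _
      simp only [hs0]
      exact hFc
    · -- derivative on the open fibre
      intro x _ t ht
      rw [hRi]
      simp only [hs0]
      exact hderiv t ht
    · intro x _
      rw [hZi]
      simp only [hs0]
  -- (ii) closed slab versus the open slab `N.domain` (null endpoints), and congruence with `N`
  have hEsub : {x : Fin 1 → ℝ | x 0 ∈ Set.Ioo α β} ⊆ R.domain := by
    rw [hRd]; exact hEC
  have hnull : volume (R.domain \ {x : Fin 1 → ℝ | x 0 ∈ Set.Ioo α β}) = 0 := by
    rw [hRd, hC]; exact hnull₀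
  have h2 : of R - of (R.restrict _ hEsa hEsub) ∈ relations :=
    R.of_sub_of_restrict_mem_relations hEsa hEsub hnull
  have h3 : of (R.restrict _ hEsa hEsub) - of N ∈ relations :=
    of_sub_of_mem_relations_of_eqOn (by rw [hNd]; rfl) fun x hx => by
      rw [IntegralRep.integrand_restrict, hRi, hNi (by rw [hNd]; exact hx)]
  have : of N - of Z = (of R - of Z) - (of R - of (R.restrict _ hEsa hEsub)) -
      (of (R.restrict _ hEsa hEsub) - of N) := by abel
  rw [this]
  exact relations.sub_mem (relations.sub_mem (newtonLeibnizRel_subset_relations hNL) h2) h3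

end Summit.KontsevichZagierPeriods.HurwitzMicroSectors.NormalFormPrinciple.PiBox.SiegeK13
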